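import Mathlib

/-!
# Clopen lemma and finiteness of isolated meeting parameters
(registered helpers `helper_leafClopen` (J4) and `helper_isolatedMeetingFinite` (J5) of line
`cross-cap-laurent`, crux `GromovRecognitionRelEnd`, item stmt-SmoothPoincare4-11009)

Two facts of pure point-set topology of the plane, used by the joint (two-family) positivity of
intersections machinery of the line.

* `helper_leafClopen`: for `u : ℂ → X` continuous and `L ⊆ X` closed, if every parameter `z` with
  `u z ∈ L` is either an interior point of `u ⁻¹' L` or an isolated point of it, and some
  parameter is interior, then `u z ∈ L` for all `z`.  Proof: the interior
  `I = {z | ∀ᶠ w in 𝓝 z, u w ∈ L}` of `u ⁻¹' L` is open and non-empty; it is also closed, because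
  a point `x` of its closure lies on the closed set `u ⁻¹' L`, and the isolated alternative at `x`
  is impossible — some point `y ∈ I` would have a neighbourhood on which `u w ∈ L` forces `w = x`,
  so `y = x` and `{x}` would be a neighbourhood of `x`, contradicting that `𝓝[≠] x` is non-trivial
  in `ℂ`.  As `ℂ` is connected, `I = univ` (`IsClopen.eq_univ`).
* `helper_isolatedMeetingFinite`: for a two-chart sphere `u, v : ℂ → X` (`v z = u z⁻¹` for
  `z ≠ 0`) and `L` closed, if every meeting parameter of `u` with `L` is isolated and `v` meets
  `L` at `0` at most in an isolated way, then `{z | u z ∈ L}` is finite: it is closed; it is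
  bounded (`v w ∉ L` for `w ≠ 0` near `0`, i.e. `u z ∉ L` near infinity, transported by
  `Filter.tendsto_inv₀_cobounded'`); hence compact (`ℂ` is proper); and it is discrete
  (`isDiscrete_iff_nhdsNE`), hence finite (`IsCompact.finite`).
-/

open Set Function Filter Bornology
open scoped Topology

-- the prescribed namespace `Summit.<P>.<Sub>.…` duplicates `SmoothPoincare4` (P = Sub)
set_option linter.dupNamespace false

namespace Summit.SmoothPoincare4.SmoothPoincare4.Theorems.GromovRecognitionRelEnd.CrossCapLaurent

/-- **J4: clopen lemma for the first alternative of positivity of intersections.**  If a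
continuous `u : ℂ → X` meets the closed set `L ⊆ X` in a parameter set `u ⁻¹' L` which, near each
of its points, is either a neighbourhood of the point or reduced to the point, and `u ⁻¹' L`
contains a neighbourhood of some parameter, then `u` maps all of `ℂ` into `L`: the interior of
`u ⁻¹' L` is a non-empty clopen subset of the connected space `ℂ`. -/
theorem helper_leafClopen : ∀ (X : Type) [TopologicalSpace X] (u : ℂ → X) (L : Set X),
    Continuous u → IsClosed L →
    (∀ z : ℂ, u z ∈ L → (∀ᶠ w in 𝓝 z, u w ∈ L) ∨ (∀ᶠ w in 𝓝[≠] z, u w ∉ L)) →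
    (∃ z : ℂ, ∀ᶠ w in 𝓝 z, u w ∈ L) → ∀ z : ℂ, u z ∈ L := by
  intro X _ u L hu hL halt hex
  -- the interior `I` of the closed parameter set `u ⁻¹' L`
  set I : Set ℂ := {z | ∀ᶠ w in 𝓝 z, u w ∈ L}
  have hIopen : IsOpen I := isOpen_setOf_eventually_nhds
  have hIclosed : IsClosed I := by
    rw [isClosed_iff_frequently]
    intro x hx
    -- `x` lies on the closed set `u ⁻¹' L`
    have hxL : u x ∈ L := by
      have hx' : ∃ᶠ y in 𝓝 x, y ∈ u ⁻¹' L :=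
        hx.mono fun y hy => (show ∀ᶠ w in 𝓝 y, u w ∈ L from hy).self_of_nhds
      exact hx'.mem_of_closed (hL.preimage hu)
    rcases halt x hxL with h1 | h2
    · exact h1
    · -- the isolated alternative at `x` contradicts `x ∈ closure I`
      exfalso
      rw [eventually_nhdsWithin_iff] at h2
      obtain ⟨y, hyI, hy⟩ := (hx.and_eventually h2.eventually_nhds).exists
      have hyI' : ∀ᶠ w in 𝓝 y, u w ∈ L := hyI
      have h3 : ∀ᶠ w in 𝓝 y, w = x := by
        filter_upwards [hyI', hy] with w hw1 hw2
        by_contra hne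
        exact hw2 hne hw1
      have hyx : y = x := h3.self_of_nhds
      rw [hyx] at h3
      have h4 : ∀ᶠ w in 𝓝[≠] x, False := by
        filter_upwards [mem_nhdsWithin_of_mem_nhds h3, self_mem_nhdsWithin] with w hw1 hw2
        exact hw2 hw1
      obtain ⟨_, h⟩ := h4.exists
      exact h
  -- `ℂ` is connected, so the non-empty clopen set `I` is everything
  have hIuniv : I = univ := IsClopen.eq_univ ⟨hIclosed, hIopen⟩ hex
  intro z
  have hz : z ∈ I := by
    rw [hIuniv]
    exact mem_univ z
  exact (show ∀ᶠ w in 𝓝 z, u w ∈ L from hz).self_of_nhds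

/-- **J5: finiteness of the intersection parameters of a two-chart sphere with a closed set met
only at isolated parameters.**  For continuous `u, v : ℂ → X` with `v z = u z⁻¹` (`z ≠ 0`) and
`L ⊆ X` closed, if every parameter `z` with `u z ∈ L` is an isolated such parameter, and `v 0 ∈ L`
only if `v w ∉ L` for `w ≠ 0` near `0`, then `{z | u z ∈ L}` is finite: it is closed, bounded
(via the chart at infinity), hence compact, and discrete. -/
theorem helper_isolatedMeetingFinite : ∀ (X : Type) [TopologicalSpace X] (u v : ℂ → X)
    (L : Set X), Continuous u → Continuous v → (∀ z : ℂ, z ≠ 0 → v z = u z⁻¹) → IsClosed L →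
    (∀ z : ℂ, u z ∈ L → ∀ᶠ w in 𝓝[≠] z, u w ∉ L) → (v 0 ∈ L → ∀ᶠ w in 𝓝[≠] (0 : ℂ), v w ∉ L) →
    {z : ℂ | u z ∈ L}.Finite := by
  intro X _ u v L hu hv huv hL hisol h0
  -- (i) the parameter set is closed
  have hZcl : IsClosed {z : ℂ | u z ∈ L} := hL.preimage hu
  -- (ii) it is bounded: `v w ∉ L` on a punctured neighbourhood of `0`
  have hv0 : ∀ᶠ w in 𝓝[≠] (0 : ℂ), v w ∉ L := by
    by_cases hmem : v 0 ∈ L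
    · exact h0 hmem
    · exact nhdsWithin_le_nhds (hv.continuousAt.eventually_mem (hL.isOpen_compl.mem_nhds hmem))
  have hbdd : Bornology.IsBounded {z : ℂ | u z ∈ L} := by
    rw [isBounded_def]
    change ∀ᶠ z in cobounded ℂ, u z ∉ L
    have h1 : ∀ᶠ w in 𝓝[≠] (0 : ℂ), u w⁻¹ ∉ L := by
      filter_upwards [hv0, self_mem_nhdsWithin] with w hw hw0
      rwa [← huv w hw0]
    simpa only [inv_inv] using Filter.tendsto_inv₀_cobounded'.eventually h1
  -- (iii) closed and bounded, hence compact; discrete, hence finite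
  have hK : IsCompact {z : ℂ | u z ∈ L} := Metric.isCompact_of_isClosed_isBounded hZcl hbdd
  refine hK.finite (isDiscrete_iff_nhdsNE.mpr fun z hz => Filter.inf_principal_eq_bot.mpr ?_)
  filter_upwards [hisol z hz] with w hw hwZ
  exact hw hwZ

end Summit.SmoothPoincare4.SmoothPoincare4.Theorems.GromovRecognitionRelEnd.CrossCapLaurent
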